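/-
Copyright (c) 2026 the pub-hodgecm-mathlib formalisation cell (harness21).  Prover seat hodgecm-mathlib-LH4-p13 (g6): Track A «(D-RAM) FOUR-FRAME» squad of crux H413,
unit U2H (ii-H), census leaf (ρ2b′-X) — socket (B) (type RamK bottom; lead LH4-p07 (g7)), organ (B-top∕ε) PART IIIb: THE SIDE LETTER AS A HILBERT SYMBOL, 2026-09-04.
-/
import Summits.HodgeConjecture.HodgeConjecture.Theorems.F0P3cDyRamOrderCountCensusRamKNormaliser   -- (this seat) part IIIa: `exists_normaliser_letters`; brings F2 ★ p858080, F1 ★ p858055, ★ p857924, ★ p857454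
import Literature.NumberTheory.LocalFields.WildQuadraticDatumNonNormUnitLevel             -- ★ `exists_fixed_unit_not_norm_of_level` (the named input `hf₀` of F1)
import HarnessLib

/-!
# F0 · P3c · line LH4 «(D-RAM) FOUR-FRAME» — socket (B), organ (B-top∕ε), part IIIb: the weld's side letter at the CM letters, `ε := (β, θ)_v`
(Rogawski 1990 §4.9; Labesse–Langlands 1979 §2; Serre 1979 Ch. V §§2–3)

Cell `pub/hodgecm-mathlib`, crux H413 = `stmt-HodgeConjecture-24833` (helper lane, count-neutral); THEOREMS ONLY (no definition, no instance, no notation, no named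
fact, no `sorry`).  LETTERS: the CM place `w ∣ v` of `L ∕ L⁺` (`σ_w`, `ι_w = toPlace v w`, `θ = cmQuadraticGenerator L`), its ramified datum `IsRamifiedQuadraticDatum σ_w ϖ d tE`
and dyadic letter `|2|_w < 1`; an ABSTRACT complete third field `M` with `jE : L_w →+* M` isometric, commuting isometric involutions `ρ`, `Θ` with `Fix ρ = jE(L_w)`,
`Θ ∘ jE = jE ∘ σ_w` and the transported datum `IsRamifiedQuadraticDatum Θ (jE ϖ) d tE` (socket (B) = `SOCKET-hOCB.v1` with `M := E′_{w₁}`, `jE := toPlace w.1 w₁`); the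
type-(B) letters `|α| ≤ 1`, `|α − ρα| = 1`, `|α − Θα| < 1`; the eigen-letters of the socket (`Θλ·λ = 1`, `λ² = tr·λ − D`, `ρλ = tr − λ`, `x² − tr·x + D` rootless in `L_w`,
`D·σD = 1`); the `U(1)` scalar `u₀ ∈ L_w¹`; the token `|λ − jE u₀| = exp(−m)` (and `|μ − ρμ| = exp(−jλ)` for the parities) with ONE depth letter `2d + 3tE ≤ m` (the head's `V`);
and the symmetrised discriminant `β ∈ L⁺_v` with `ι β = −χ(u₀² + D)∕(2u₀²D)`, `χ = u₀² − tr·u₀ + D`.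

WHAT IS PROVED — F0P3-p01 (g33)'s ★ p858068 `toricCensusSum_ramK_weld` side hypothesis AT THESE LETTERS, with `ε := ((β, θ)_v : ℤ)` cast to `ℚ`:
**`btop_side_symbol_cm … : 3d ≤ jλ + 2 → ∃ c₀, 2d ≤ c₀ + 1 ∧ c₀ + d ≤ jλ + 1 ∧ ((((β,θ)_v : ℤ) : ℚ) = 1 ↔ BIT(h, λ − jE u₀, c₀))`** (= `hside`; the token facts
`hd2 hjlS hmpar hmS` are part IIIa's `btop_tokens_cm`).  Route: part IIIa's normaliser `ν := jE ν₀`; F2 §3 (`SIDE ↔ BIT` at `c₀ = 2d − 1`); F1 §3 (`SIDE ↔ κρκ ∈ N_{E∕F}`, its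
named input `hf₀` DISCHARGED here from ★ `exists_fixed_unit_not_norm_of_level` on `L_w` at level `1 ≤ d − 1`); ★ `hilbertSymbol_eq_one_iff_exists_norm_toPlace`
(`κρκ ∈ N_{E∕F} ↔ (N, θ)_v = 1`); and `(β, θ)_v = (x, θ)_v = (N, θ)_v` by ★ p857924 §1–§2 over the one-field identity ★ p857819 §2 `x′·N₁·N₂ = −ω²·κρκ` at `ω := jE √θ`
(★ p857454 §1), with `(N₂, θ)_v = 1` (a norm from `L_w`) and `(N₁, θ)_v = 1` (`N₁∕4 ≡ 1 (mod ϖ^{2d−1})`, ★ p857454 §3 — where the `3tE` of the depth letter is spent).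

HONEST LABEL: HC_CM is proved only modulo the 7 printed citations (2 remaining named inputs: hLiu418 = stmt-HodgeConjecture-24832, h413 = stmt-HodgeConjecture-24833) until rung 0
closes; (ρ2b′-X) :418 is an OPEN prover target — this file is a helper (`--supports`), proofs only; socket (B) is OPEN (lead LH4-p07 (g7) composes).

## References
* [Rogawski1990] J. D. Rogawski, *Automorphic Representations of Unitary Groups in Three Variables*, Ann. of Math. Stud. 123 (1990), §4.9 Prop. 4.9.1 (b) p. 55, Lemma 4.9.3 p. 56.
* [LabesseLanglands1979] J.-P. Labesse, R. P. Langlands, *L-indistinguishability for SL(2)*, Canad. J. Math. 31 (1979), §2 (2.1)–(2.2).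
* [Serre1979] J.-P. Serre, *Local Fields*, GTM 67 (1979), Ch. V §2 Prop. 3, §3 Cor. 3; Ch. XIV §§3–4.
-/

set_option autoImplicit false

noncomputable section

open NumberField IsDedekindDomain WithZero IsLocalRing
open Literature.NumberTheory.Automorphic Literature.NumberTheory.Automorphic.UnitaryGroup Literature.NumberTheory.GaloisRepresentations
open Literature.NumberTheory.QuadraticForms Literature.NumberTheory.Rogawski1990
open Literature.NumberTheory.Automorphic.UnitaryThreeFourFrame
open scoped Valued

namespace Summit.HodgeConjecture.HodgeConjecture.Cruxes.H413.F0P3cDyRamOrderCountCensusRamKSymbol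

open Literature.NumberTheory.LocalFields.WildQuadraticDatum (v_varpi_pow exists_fixed_unit_not_norm_of_level)
open Summit.HodgeConjecture.HodgeConjecture.Cruxes.H413.F0P3cDyRamTokenSignUnr (exists_antifixed_sq_eq_toPlace_cmQuadraticGenerator exists_toPlace_eq_of_fixed
  hilbertSymbol_eq_one_of_valued_toPlace_sub_one_le)
open Summit.HodgeConjecture.HodgeConjecture.Cruxes.H413.F0P3cDyRamTokenSignDepthSymbol (valued_eq_one_of_map_mul_self hilbertSymbol_token_eq_hilbertSymbol_depth
  hilbertSymbol_eq_of_mul_mul_eq_neg_mul)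
open Summit.HodgeConjecture.HodgeConjecture.Cruxes.H413.F0P3cDyRamTokenSignRamK (theta_map_signKappa traceDiff_mul_norms_eq_neg_sq_mul_norm_signKappa)
open Summit.HodgeConjecture.HodgeConjecture.Cruxes.H413.F0P3cDyRamSideNormCriterionRamK (two_le_of_datum_of_v_two_lt_one v_eq_one_of_mul_theta_eq side_iff_exists_norm)
open Summit.HodgeConjecture.HodgeConjecture.Cruxes.H413.F0P3cDyRamOrderCountCensusRamKTop (btop_side_ramK)
open Summit.HodgeConjecture.HodgeConjecture.Cruxes.H413.F0P3cDyRamOrderCountCensusRamKNormaliser (exists_normaliser_letters)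

variable (L : Type) [Field L] [NumberField L] [IsCMField L] {v : HeightOneSpectrum (𝓞 ↥(maximalRealSubfield L))}
  (w : PlacesOver L v) (hw : IsCMField.complexConj L • w.1 = w.1)

/-! ## The side letter of the weld with `ε := (β, θ)_v` -/

include hw in
/-- **THE SIDE LETTER `hside` OF THE WELD WITH `ε := ((β, θ)_v : ℤ) : ℚ`** at the CM letters (see the module docstring for the route).  If far cells exist (`3d ≤ jλ + 2`), then at
some `c₀` with `2d ≤ c₀ + 1`, `c₀ + d ≤ jλ + 1` (namely `c₀ = 2d − 1`): `(β, θ)_v = 1 ↔ BIT(h, λ − jE u₀, c₀)`.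
[cite: Rogawski1990, §4.9 Prop. 4.9.1 (b) p. 55, Lemma 4.9.3 p. 56] [cite: LabesseLanglands1979, §2 (2.1)–(2.2)] [cite: Serre1979, Ch. V §2 Prop. 3, §3 Cor. 3] -/
theorem btop_side_symbol_cm [Fintype (Valued.ResidueField (w.1.adicCompletion L))]
    (ϖ : w.1.adicCompletion L) (d tE : ℕ) (hD : IsRamifiedQuadraticDatum (galAdicCompletionMap (L := L) (IsCMField.complexConj L) hw) ϖ d tE)
    (h2v : Valued.v (2 : w.1.adicCompletion L) < 1)
    {M : Type} [Field M] [Valued M ℤᵐ⁰] [CompleteSpace M] [Finite 𝓀[M]] (jE : w.1.adicCompletion L →+* M) (hjv : ∀ a, Valued.v (jE a) = Valued.v a)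
    (ρ Θ : M →+* M) (hρρ : ∀ z, ρ (ρ z) = z) (hvρ : ∀ z, Valued.v (ρ z) = Valued.v z) (hΘρ : ∀ z, Θ (ρ z) = ρ (Θ z))
    (hjfix : ∀ z, ρ z = z ↔ ∃ a, jE a = z) (hΘj : ∀ a, Θ (jE a) = jE (galAdicCompletionMap (L := L) (IsCMField.complexConj L) hw a))
    (hDΘ : IsRamifiedQuadraticDatum Θ (jE ϖ) d tE)
    {α : M} (hα1 : Valued.v α ≤ 1) (hα : Valued.v (α - ρ α) = 1) (hram : Valued.v (α - Θ α) < 1)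
    {h : M} (hΘh : Θ h = h) (hh : h ≠ 0) (hhyper : ∃ x : M, x ≠ 0 ∧ h * Θ x * x + ρ (h * Θ x * x) = 0)
    {lam : M} {tr D : w.1.adicCompletion L} (hΘlam : Θ lam * lam = 1) (hlam2 : lam * lam = jE tr * lam - jE D) (hρlam : ρ lam = jE tr - lam)
    (hirr : ∀ x : w.1.adicCompletion L, x * x - tr * x + D ≠ 0) (hDσ : D * galAdicCompletionMap (L := L) (IsCMField.complexConj L) hw D = 1)
    {u₀ : w.1.adicCompletion L} (hσu₀ : galAdicCompletionMap (L := L) (IsCMField.complexConj L) hw u₀ * u₀ = 1)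
    {m jl : ℕ} (hm : Valued.v (lam - jE u₀) = exp (-(m : ℤ))) (hm0 : 2 * d + 3 * tE ≤ m)
    (β : v.adicCompletion ↥(maximalRealSubfield L)) {χ : w.1.adicCompletion L} (hχ : χ = u₀ ^ 2 - tr * u₀ + D)
    (hβ : toPlace v w β = -(χ * (u₀ ^ 2 + D)) / (2 * u₀ ^ 2 * D)) :
    3 * d ≤ jl + 2 → ∃ c₀ : ℕ, 2 * d ≤ c₀ + 1 ∧ c₀ + d ≤ jl + 1 ∧
      ((((hilbertSymbol (v.adicCompletion ↥(maximalRealSubfield L)) β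
            (algebraMap ↥(maximalRealSubfield L) _ ((cmQuadraticGenerator L : 𝓞 ↥(maximalRealSubfield L)) : ↥(maximalRealSubfield L))) : ℤ) : ℚ) = 1) ↔
        ∃ ω₁ : Mˣ, Valued.v (ω₁ : M) = 1 ∧
          Valued.v (1 + ρ h / h / (ρ (lam - jE u₀) / (lam - jE u₀)) * (ρ ((ω₁ : M) * Θ ω₁) / ((ω₁ : M) * Θ ω₁))) ≤ exp (-(c₀ : ℤ))) := by
  intro hfar
  haveI : CharZero (v.adicCompletion ↥(maximalRealSubfield L)) :=
    charZero_of_injective_algebraMap (algebraMap ↥(maximalRealSubfield L) (v.adicCompletion ↥(maximalRealSubfield L))).injective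
  have hD' := hD
  obtain ⟨hσσ, hσv, hϖ, -, -, hd1, h2t⟩ := hD'
  obtain ⟨hd2, -, ht1⟩ := two_le_of_datum_of_v_two_lt_one hD h2v
  set σ := galAdicCompletionMap (L := L) (IsCMField.complexConj L) hw with hσdef
  set θv : v.adicCompletion ↥(maximalRealSubfield L) :=
    algebraMap ↥(maximalRealSubfield L) _ ((cmQuadraticGenerator L : 𝓞 ↥(maximalRealSubfield L)) : ↥(maximalRealSubfield L)) with hθvdef
  have hθ0 : θv ≠ 0 := by
    rw [hθvdef, Ne, map_eq_zero_iff _ (algebraMap ↥(maximalRealSubfield L) (v.adicCompletion ↥(maximalRealSubfield L))).injective]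
    exact fun h0 => not_isSquare_cmQuadraticGenerator L (by rw [h0]; exact IsSquare.zero)
  have hπ : ∀ n : ℕ, Valued.v ϖ ^ n = exp (-(n : ℤ)) := v_varpi_pow hϖ
  have hι : Function.Injective (toPlace v w) := (toPlace v w).injective
  have hjι : Function.Injective (fun y => jE (toPlace v w y)) := jE.injective.comp hι
  -- ## the letters of §2
  obtain ⟨ν₀, mlam, hνν, hσν, hdeep, hρu, hu1, hρν, hν1, hdet, hν2, hlam1, hmm, h2M⟩ :=
    exists_normaliser_letters L w hw ϖ d tE hD h2v jE hjv ρ Θ hvρ hjfix hΘj hlam2 hρlam hirr hDσ hσu₀ hm (by omega)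
  have hΘΘ : ∀ z, Θ (Θ z) = z := hDΘ.1
  have hΘv : ∀ z, Valued.v (Θ z) = Valued.v z := hDΘ.2.1
  have hρΘ : ∀ z, ρ (Θ z) = Θ (ρ z) := fun z => (hΘρ z).symm
  have hρϖ : ρ (jE ϖ) = jE ϖ := (hjfix _).2 ⟨ϖ, rfl⟩
  have hlam : lam * Θ lam = 1 := by rw [mul_comm]; exact hΘlam
  have hvu : Valued.v u₀ = 1 := valued_eq_one_of_map_mul_self L w hσv hσu₀
  have hu0 : u₀ ≠ 0 := fun h0 => by rw [h0, map_zero] at hvu; exact zero_ne_one hvu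
  have hvν : Valued.v ν₀ = 1 := valued_eq_one_of_map_mul_self L w hσv hσν
  have hν0 : ν₀ ≠ 0 := fun h0 => by rw [h0, map_zero] at hvν; exact zero_ne_one hvν
  have hjν0 : jE ν₀ ≠ 0 := (map_ne_zero jE).2 hν0
  have hju0 : jE u₀ ≠ 0 := (map_ne_zero jE).2 hu0
  have hlam0 : lam ≠ 0 := fun h0 => by rw [h0, mul_zero] at hΘlam; exact zero_ne_one hΘlam
  have hμ0 : lam - jE u₀ ≠ 0 := fun h0 => by rw [h0, map_zero] at hm; exact (exp_ne_zero hm.symm).elim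
  have hχ0 : χ ≠ 0 := by rw [hχ, sq]; exact hirr u₀
  -- ## `ω := jE √θ`
  obtain ⟨s, hs0, hσs, hs2⟩ := exists_antifixed_sq_eq_toPlace_cmQuadraticGenerator L w hw
  have hρω : ρ (jE s) = jE s := (hjfix _).2 ⟨s, rfl⟩
  have hΘω : Θ (jE s) = -jE s := by rw [hΘj, hσs, map_neg]
  have hω0 : jE s ≠ 0 := (map_ne_zero jE).2 hs0
  -- ## the named input `hf₀` of F1: a principal unit of `F` that is not a norm from `E`
  have hf₀ : ∃ f₀ : M, ρ f₀ = f₀ ∧ Θ f₀ = f₀ ∧ Valued.v (f₀ - 1) < 1 ∧ ¬ ∃ e : M, ρ e = e ∧ e * Θ e = f₀ := by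
    haveI := Literature.NumberTheory.Automorphic.isAdicComplete_valuedMaximalIdeal_valuedInteger_adicCompletion L w.1
    obtain ⟨c, hσc, -, hc1, hcn⟩ := exists_fixed_unit_not_norm_of_level σ ϖ d tE hD (n := 1) (by omega)
    refine ⟨jE c, (hjfix _).2 ⟨c, rfl⟩, by rw [hΘj, hσc], ?_, ?_⟩
    · rw [← map_one jE, ← map_sub, hjv]
      refine hc1.trans_lt ?_
      rw [← exp_zero, exp_lt_exp]; norm_num
    · rintro ⟨e, hρe, he⟩
      obtain ⟨a, rfl⟩ := (hjfix e).1 hρe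
      refine hcn ⟨a, jE.injective ?_⟩
      rw [map_mul, ← hΘj, he]
  -- ## F2 §3: `SIDE ↔ BIT` at `c₀ = 2d − 1`
  obtain ⟨c₀, hc₀1, hc₀2, hSB⟩ := btop_side_ramK hρρ hvρ hΘρ hα1 hα hDΘ hρϖ h2M hram hf₀ hΘh hh hhyper hlam hρu hu1 hρν hν1 hdet hρω hΘω hω0
    hm hlam1 (by omega) hν2 hfar
  refine ⟨c₀, hc₀1, hc₀2, ?_⟩
  rw [← hSB, Int.cast_eq_one]
  -- ## primed letters and the S9 element `κ`
  set lam' : M := lam / jE ν₀ with hlam'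
  set u' : M := jE u₀ / jE ν₀ with hu'
  have hlamΘ' : lam' * Θ lam' = 1 := by rw [hlam', map_div₀, div_mul_div_comm, hlam, hν1, div_one]
  have hlamρ' : lam' * ρ lam' = 1 := by
    rw [hlam', map_div₀, hρν, div_mul_div_comm, hdet, sq, div_self (mul_ne_zero hjν0 hjν0)]
  have hρu' : ρ u' = u' := by rw [hu', map_div₀, hρu, hρν]
  have hu1' : u' * Θ u' = 1 := by rw [hu', map_div₀, div_mul_div_comm, hu1, hν1, div_one]
  set κ : M := (lam' - u') * (1 + lam') * (1 + u') / (jE s * lam' * u') with hκdef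
  have hκ : κ = (lam - jE u₀) * (jE ν₀ + lam) * (jE ν₀ + jE u₀) / (jE s * jE ν₀ * lam * jE u₀) := by
    rw [hκdef, hlam', hu']; field_simp
  have hΘκ : Θ κ = κ := theta_map_signKappa hlamΘ' hu1' hΘω
  -- valuations of the primed letters
  have h2Mt : Valued.v (2 : M) = exp (-(tE : ℤ)) := by rw [← map_ofNat jE 2, hjv, h2t, hπ]
  have h20M : (2 : M) ≠ 0 := fun h0 => by rw [h0, map_zero] at h2Mt; exact (exp_ne_zero h2Mt.symm).elim
  have hvν' : Valued.v (jE ν₀) = 1 := by rw [hjv, hvν]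
  have hlam'1 : Valued.v (lam' - 1) = exp (-(mlam : ℤ)) := by
    rw [hlam', show lam / jE ν₀ - 1 = (lam - jE ν₀) / jE ν₀ by field_simp, map_div₀, hvν', div_one, hlam1]
  have hu'1 : Valued.v (u' - 1) < Valued.v (2 : M) := by
    rw [hu', show jE u₀ / jE ν₀ - 1 = (jE u₀ - jE ν₀) / jE ν₀ by field_simp, map_div₀, hvν', div_one]; exact hν2
  have h1lamv : Valued.v (1 + lam') = Valued.v (2 : M) := by
    have hlt : Valued.v (lam' - 1) < Valued.v (2 : M) := by rw [hlam'1, h2Mt, exp_lt_exp]; omega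
    rw [show 1 + lam' = 2 + (lam' - 1) by ring, Valuation.map_add_eq_of_lt_left _ hlt]
  have h1uv : Valued.v (1 + u') = Valued.v (2 : M) := by
    rw [show 1 + u' = 2 + (u' - 1) by ring, Valuation.map_add_eq_of_lt_left _ hu'1]
  have h1lam0 : 1 + lam' ≠ 0 := fun h0 => h20M ((Valuation.zero_iff _).1 (by rw [← h1lamv, h0, map_zero]))
  have h1u0 : 1 + u' ≠ 0 := fun h0 => h20M ((Valuation.zero_iff _).1 (by rw [← h1uv, h0, map_zero]))
  have hlam'0 : lam' ≠ 0 := div_ne_zero hlam0 hjν0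
  have hu'0 : u' ≠ 0 := div_ne_zero hju0 hjν0
  have hne' : lam' - u' ≠ 0 := by rw [hlam', hu', ← sub_div]; exact div_ne_zero hμ0 hjν0
  have hκ0 : κ ≠ 0 := by
    rw [hκdef]
    exact div_ne_zero (mul_ne_zero (mul_ne_zero hne' h1lam0) h1u0) (mul_ne_zero (mul_ne_zero hω0 hlam'0) hu'0)
  -- ## F1 §3: `SIDE ↔ κρκ ∈ N_{E∕F}`
  have hF1 := side_iff_exists_norm hρρ hvρ hΘρ hDΘ hρϖ h2M hα1 hα hram hf₀ hΘκ hκ0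
  rw [← hκ, hF1]
  -- ## `N ∈ L⁺_v` with `jE (ι N) = κρκ`, and `(N, θ)_v = 1 ↔ κρκ ∈ N_{E∕F}`
  have hρN : ρ (κ * ρ κ) = κ * ρ κ := by rw [map_mul, hρρ, mul_comm]
  have hΘN : Θ (κ * ρ κ) = κ * ρ κ := by rw [map_mul, hΘρ, hΘκ]
  have hρκ0 : ρ κ ≠ 0 := (map_ne_zero ρ).2 hκ0
  have hNM0 : κ * ρ κ ≠ 0 := mul_ne_zero hκ0 hρκ0
  obtain ⟨cN, hcN⟩ := (hjfix _).1 hρN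
  have hσcN : σ cN = cN := jE.injective (by rw [← hΘj, hcN, hΘN])
  obtain ⟨N, hN⟩ := exists_toPlace_eq_of_fixed L w hw cN hσcN
  have hN0 : N ≠ 0 := by
    intro h0
    rw [h0, map_zero] at hN
    rw [← hN, map_zero] at hcN
    exact hNM0 hcN.symm
  have hNiff : hilbertSymbol (v.adicCompletion ↥(maximalRealSubfield L)) N θv = 1 ↔ ∃ e : M, ρ e = e ∧ e * Θ e = κ * ρ κ := by
    rw [hilbertSymbol_eq_one_iff_exists_norm_toPlace L v w hw hN0]
    constructor
    · rintro ⟨z, hz⟩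
      refine ⟨jE z, (hjfix _).2 ⟨z, rfl⟩, ?_⟩
      rw [hΘj, ← map_mul, mul_comm, hz, hN, hcN]
    · rintro ⟨e, hρe, he⟩
      obtain ⟨a, rfl⟩ := (hjfix e).1 hρe
      refine ⟨a, jE.injective ?_⟩
      rw [map_mul, ← hΘj, mul_comm, he, ← hcN, hN]
  rw [← hNiff]
  -- ## it remains: `(β, θ)_v = (N, θ)_v`
  suffices hβN : hilbertSymbol (v.adicCompletion ↥(maximalRealSubfield L)) β θv =
      hilbertSymbol (v.adicCompletion ↥(maximalRealSubfield L)) N θv by rw [hβN]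
  -- `Θλ' = ρλ' = λ'⁻¹`, `Θu' = u'⁻¹`
  have hΘlam' : Θ lam' = lam'⁻¹ := eq_inv_of_mul_eq_one_right hlamΘ'
  have hρlam' : ρ lam' = lam'⁻¹ := eq_inv_of_mul_eq_one_right hlamρ'
  have hΘu'' : Θ u' = u'⁻¹ := eq_inv_of_mul_eq_one_right hu1'
  have hσu₀' : σ u₀ = u₀⁻¹ := eq_inv_of_mul_eq_one_left hσu₀
  have hσν' : σ ν₀ = ν₀⁻¹ := eq_inv_of_mul_eq_one_left hσν
  -- ## the depth letter `x`: `ι x = −χ∕(u₀ν₀)`, `jE (ι x) = (λ' + ρλ') − (u' + Θu')`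
  set x' : M := (lam' + ρ lam') - (u' + Θ u') with hx'
  have hjx : jE (-χ / (u₀ * ν₀)) = x' := by
    have htr : jE tr = lam + ρ lam := by rw [hρlam]; ring
    have hjD : jE D = jE ν₀ * jE ν₀ := by rw [← map_mul, hνν]
    have e1 : jE (-χ / (u₀ * ν₀)) = -(jE u₀ ^ 2 - jE tr * jE u₀ + jE D) / (jE u₀ * jE ν₀) := by
      rw [hχ, map_div₀, map_neg, map_add, map_sub, map_pow, map_mul, map_mul]
    rw [e1, htr, hjD, hx', hlam', hu']
    simp only [map_div₀, hρν, hΘj, hσu₀', hσν', map_inv₀]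
    field_simp
    ring
  have hΘx' : Θ x' = x' := by
    rw [hx', map_sub, map_add, map_add, hΘlam', ← hρΘ, hΘlam', map_inv₀, hρlam', inv_inv, hΘΘ, hΘu'']; ring
  have hσx : σ (-χ / (u₀ * ν₀)) = -χ / (u₀ * ν₀) := jE.injective (by rw [← hΘj, hjx, hΘx'])
  obtain ⟨x, hx⟩ := exists_toPlace_eq_of_fixed L w hw _ hσx
  -- ## `(β, θ)_v = (x, θ)_v` (★ p857924 §1 at `u := u₀`, `δ := ν₀`, `n := m − tE`)
  have hβx := hilbertSymbol_token_eq_hilbertSymbol_depth L w hw ϖ d tE hD hσu₀ hνν hσν hχ0 (n := m - tE) (by omega) (by omega) hdeep hβ hx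
  rw [hβx]
  -- ## `N₁`: `jE (ι N₁) = (1 + λ')(1 + ρλ')`, a unit `≡ 4`, so `(N₁, θ)_v = 1`
  set N₁' : M := (1 + lam') * (1 + ρ lam') with hN₁'
  have hρN₁ : ρ N₁' = N₁' := by rw [hN₁', map_mul, map_add, map_add, map_one, hρρ]; ring
  have hΘN₁ : Θ N₁' = N₁' := by
    rw [hN₁', map_mul, map_add, map_add, map_one, hΘlam', ← hρΘ, hΘlam', map_inv₀, hρlam', inv_inv]; ring
  obtain ⟨c₁, hc₁⟩ := (hjfix _).1 hρN₁
  have hσc₁ : σ c₁ = c₁ := jE.injective (by rw [← hΘj, hc₁, hΘN₁])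
  obtain ⟨N₁, hN₁⟩ := exists_toPlace_eq_of_fixed L w hw c₁ hσc₁
  have hN₁4 : N₁' - 4 = (lam' - 1) + ρ (lam' - 1) := by
    rw [hN₁', map_sub, map_one]
    linear_combination hlamρ'
  have hvN₁4 : Valued.v (N₁' - 4) ≤ exp (-(mlam : ℤ)) := by
    rw [hN₁4]
    refine (Valuation.map_add _ _ _).trans (max_le ?_ ?_)
    · rw [hlam'1]
    · rw [hvρ, hlam'1]
  have h4w : Valued.v (4 : w.1.adicCompletion L) = exp (-(2 * (tE : ℤ))) := by
    rw [show (4 : w.1.adicCompletion L) = 2 * 2 by norm_num, Valuation.map_mul, h2t, hπ, ← exp_add]; ring_nf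
  have h40 : (4 : w.1.adicCompletion L) ≠ 0 := fun h0 => by rw [h0, map_zero] at h4w; exact (exp_ne_zero h4w.symm).elim
  have h40v : (4 : v.adicCompletion ↥(maximalRealSubfield L)) ≠ 0 := by
    intro h0; apply h40; rw [← map_ofNat (toPlace v w) 4, h0, map_zero]
  have hyv : Valued.v (toPlace v w (N₁ / 4) - 1) ≤ Valued.v ϖ ^ (mlam - 2 * tE) := by
    have h1 : toPlace v w (N₁ / 4) - 1 = (c₁ - 4) / 4 := by rw [map_div₀, map_ofNat, hN₁]; field_simp
    rw [h1, map_div₀, h4w, hπ, ← hjv, map_sub, hc₁, map_ofNat, div_eq_mul_inv, ← exp_neg, neg_neg]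
    calc Valued.v (N₁' - 4) * exp (2 * (tE : ℤ)) ≤ exp (-(mlam : ℤ)) * exp (2 * (tE : ℤ)) := by gcongr
      _ = exp (-((mlam - 2 * tE : ℕ) : ℤ)) := by rw [← exp_add]; congr 1; omega
  have hy1 : hilbertSymbol (v.adicCompletion ↥(maximalRealSubfield L)) (N₁ / 4) θv = 1 :=
    hilbertSymbol_eq_one_of_valued_toPlace_sub_one_le L w hw ϖ d tE hD (N := mlam - 2 * tE) (by omega) hyv
  have hN₁v : Valued.v N₁' = Valued.v (2 : M) * Valued.v (2 : M) := by
    rw [hN₁', Valuation.map_mul, h1lamv, show 1 + ρ lam' = ρ (1 + lam') by rw [map_add, map_one], hvρ, h1lamv]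
  have hN₁0 : N₁ ≠ 0 := by
    intro h0
    rw [h0, map_zero] at hN₁
    rw [← hN₁, map_zero] at hc₁
    rw [← hc₁, map_zero] at hN₁v
    exact mul_ne_zero ((Valuation.ne_zero_iff _).2 h20M) ((Valuation.ne_zero_iff _).2 h20M) hN₁v.symm
  have hy0 : N₁ / 4 ≠ 0 := div_ne_zero hN₁0 h40v
  have hN₁θ : hilbertSymbol (v.adicCompletion ↥(maximalRealSubfield L)) N₁ θv = 1 := by
    rw [show N₁ = 4 * (N₁ / 4) by field_simp, hilbertSymbol_adicCompletion_mul_left ↥(maximalRealSubfield L) v h40v hy0 hθ0, hy1, mul_one]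
    exact hilbertSymbol_eq_one_of_isSquare ⟨2, by norm_num⟩ h40v θv
  -- ## `N₂`: `ι N₂ = (1 + u₀')·σ(1 + u₀')`, a norm from `L_w`
  set u₀' : w.1.adicCompletion L := u₀ / ν₀ with hu₀'
  have hju' : jE u₀' = u' := by rw [hu₀', hu', map_div₀]
  have hσc₂ : σ ((1 + u₀') * σ (1 + u₀')) = (1 + u₀') * σ (1 + u₀') := by rw [map_mul, hσσ, mul_comm]
  obtain ⟨N₂, hN₂⟩ := exists_toPlace_eq_of_fixed L w hw _ hσc₂
  have hjN₂ : jE (toPlace v w N₂) = (1 + u') * (1 + Θ u') := by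
    rw [hN₂, map_mul, ← hΘj, map_add, map_one, hju', map_add, map_one]
  have hN₂v : Valued.v ((1 + u') * (1 + Θ u')) = Valued.v (2 : M) * Valued.v (2 : M) := by
    rw [Valuation.map_mul, h1uv, show 1 + Θ u' = Θ (1 + u') by rw [map_add, map_one], hΘv, h1uv]
  have hN₂0 : N₂ ≠ 0 := by
    intro h0
    rw [h0, map_zero, map_zero] at hjN₂
    rw [← hjN₂] at hN₂v
    rw [map_zero] at hN₂v
    exact mul_ne_zero ((Valuation.ne_zero_iff _).2 h20M) ((Valuation.ne_zero_iff _).2 h20M) hN₂v.symm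
  have hN₂θ : hilbertSymbol (v.adicCompletion ↥(maximalRealSubfield L)) N₂ θv = 1 :=
    (hilbertSymbol_eq_one_iff_exists_norm_toPlace L v w hw hN₂0).2 ⟨1 + u₀', by rw [hN₂, mul_comm]⟩
  -- ## the identity `x·N₁·N₂ = −θ·N` in `L⁺_v` (★ p857819 §2 pulled back along `jE ∘ ι`)
  have hS9 := traceDiff_mul_norms_eq_neg_sq_mul_norm_signKappa hlamρ' hρu' hu1' hρω hω0
  have hident : x * N₁ * N₂ = -(θv * N) := by
    apply hjι
    change jE (toPlace v w (x * N₁ * N₂)) = jE (toPlace v w (-(θv * N)))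
    rw [map_mul, map_mul, map_mul, map_mul, hx, hjx, hN₁, hc₁, hjN₂, map_neg, map_mul, map_neg, map_mul, hN, hcN, ← hs2,
      map_pow, hx', hN₁']
    rw [hκdef]
    exact hS9
  have hx'0 : x' ≠ 0 := by
    intro h0
    have h1 := hS9
    rw [← hx', h0, zero_mul, zero_mul] at h1
    exact mul_ne_zero (pow_ne_zero 2 hω0) hNM0 (neg_eq_zero.1 h1.symm)
  have hx0 : x ≠ 0 := by
    intro h0
    rw [h0, map_zero] at hx
    rw [← hx, map_zero] at hjx
    exact hx'0 hjx.symm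
  exact hilbertSymbol_eq_of_mul_mul_eq_neg_mul L (v := v) hx0 hN₁0 hN₂0 hN0 hθ0 hident hN₁θ hN₂θ

end Summit.HodgeConjecture.HodgeConjecture.Cruxes.H413.F0P3cDyRamOrderCountCensusRamKSymbol

end
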